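import Literature.Combinatorics.Sahi2008.Functional
import Literature.Probability.LatticeModels.SahiThirdOrderCorrelation
import HarnessLib

/-!
# Lieb–Sahi (2022), Definition 3.1 / Proposition 3.3 on a general probability space: the measure-level `E_n`

Topic `Literature/Combinatorics/Sahi2008` (sequel of `Functional.lean`, whose `sahiE μ n f` is Sahi's `E_n` for a
finite WEIGHT `μ : α → ℝ` on a finite type).  Lieb–Sahi state the definition of `E_n` for "functions
`f^1,…,f^n` on a probability space `X`" [LiebSahi2021, Def. 3.1; §3.1 "In this subsection and the next we work
with arbitrary functions on a probability space"], and their continuum theorems (Thm. 2.1, Thm. 3.5, Thm. 3.7: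
Lebesgue measure on `[0,1]^k`) need exactly that generality.  This file supplies it.

## Source (read 2026-08-20 from the materialised arXiv text, corpus `paper:arxiv-2107.09838`, pp. 3, 5, 7)

E. H. Lieb, S. Sahi, *On the extension of the FKG inequality to `n` functions*, J. Math. Phys. **63** (2022)
043301 = arXiv:2107.09838 [LiebSahi2021]:
> "For functions `f, g` on a probability space `(L, μ)` … `E_1(f) = 𝔼(f) := ∫_L f dμ` and
> `E_2(f,g) = 𝔼(fg) − 𝔼(f)𝔼(g)`." (eq. (1.1))
> "**Definition 3.1.** For functions `f^1,…,f^n` on a probability space `X` we define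
> `E_n(f^1,…,f^n) = Σ_{σ ∈ S_n} (−1)^{C_σ−1} E_σ(f^1,…,f^n)`", `E_σ = 𝔼(f^{i_1}⋯f^{i_p}) 𝔼(f^{j_1}⋯f^{j_q}) ⋯`.
> "**Proposition 3.3.** We have `E_n(f^1,…,f^{n−1},f) = e_1 + ⋯ + e_{n−1} − e_n` where
> `e_i = E_{n−1}(f^1,…,f^i f,…,f^{n−1})` if `1 ≤ i ≤ n−1`, `e_n = E_{n−1}(f^1,…,f^{n−1}) 𝔼(f)`."

## What is here (everything PROVED; no named facts; axioms standard)

* `momentE n M` — `E_n` as a function of the JOINT-MOMENT VECTOR `M : Finset (Fin n) → ℝ`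
  (`M S` standing for `𝔼(Π_{i∈S} f_i)`): the Lieb–Sahi recursion written at the level of moments.  Each `E_σ` in
  Definition 3.1 is a product of joint moments, so `E_n` is a fixed polynomial in them; `momentE n` is that
  polynomial, generated by Prop. 3.3.  `sahiE_eq_momentE` (the tree's finite-weight `E_n` factors through it),
  `continuous_momentE` (used for limit passages such as [LiebSahi2021, Lemma 2.3 / Lemma 3.8]).
* `msahiE (μ : Measure Ω) n f` — **`E_n` for real functions on a measure space**, defined by the same recursion
  as `sahiE` with `𝔼 = ∫ · dμ` (Bochner integral); `msahiE_succ_succ` (Prop. 3.3, definitional), the closed forms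
  `msahiE_one`, `msahiE_two` (eq. (1.1)), `msahiE_three` (eq. (2.1)); `msahiE_eq_momentE`; the moment-congruence
  principles `msahiE_congr_of_moments` (two measures) and `msahiE_eq_sahiE_of_moments` (a measure and a finite
  weight with the same joint moments have the same `E_n` — the bridge used to discretise);
  `MSahiPositive μ n` — Sahi positivity of order `n` of a measure on a measurable preorder (the property
  `E_n(f) ≥ 0` for nonnegative monotone families; `n = 2` is positive association).
* CONSISTENCY with the tree: `msahiE_weightMeasure` — for a nonnegative finite weight `w` the measure-level
  `E_n` under `Σ_a w(a) δ_a` is the finite `sahiE w n`; `msahiE_three_indicator` — on indicators of three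
  measurable events `msahiE μ 3` is the event-level `Literature.Probability.LatticeModels.sahiE3 μ A B C`
  ([LiebSahi2021, (2.1)] for `f = 1_A, g = 1_B, h = 1_C`).

Motivation (this programme, crux `stmt-CriticalPhenomena-4575`, cell prim-sahi): the continuum theorems of
[LiebSahi2021] (Thm. 2.1 / 3.7: Lebesgue measure on the unit square; file `LebesgueSquare.lean`) are stated with
this `E_n`.  NOTHING here asserts Sahi's conjecture; `MSahiPositive` is a predicate used as a conclusion of proved
theorems only.
-/

noncomputable section

namespace Literature.Combinatorics.Sahi2008

open Finset Function MeasureTheory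

/-! ### Plumbing: joint moments of the peeled families -/

/-- Products over the tail of a family are products over the shifted index set. [folklore] -/
private theorem prod_tail_eq_prod_map' {γ : Type*} {n : ℕ} (F : Fin (n + 2) → γ → ℝ)
    (S : Finset (Fin (n + 1))) :
    ∏ j ∈ S, Fin.tail F j = ∏ j ∈ S.map (Fin.succEmb (n + 1)), F j := by
  rw [prod_map]
  rfl

/-- `0` is not a successor. [folklore] -/
private theorem zero_notMem_map_succEmb' {n : ℕ} (S : Finset (Fin (n + 1))) :
    (0 : Fin (n + 2)) ∉ S.map (Fin.succEmb (n + 1)) := by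
  rw [Finset.mem_map]
  rintro ⟨a, _, ha⟩
  exact Fin.succ_ne_zero a ha

/-- The product over `S ∋ i` of the tail family with slot `i` multiplied by the head is the product of the
original family over `{0} ∪ (S+1)`. [folklore] -/
private theorem prod_update_tail_mul_head' {γ : Type*} {n : ℕ} (F : Fin (n + 2) → γ → ℝ)
    {S : Finset (Fin (n + 1))} {i : Fin (n + 1)} (hi : i ∈ S) :
    ∏ j ∈ S, update (Fin.tail F) i (Fin.tail F i * F 0) j =
      ∏ j ∈ insert (0 : Fin (n + 2)) (S.map (Fin.succEmb (n + 1))), F j := by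
  rw [prod_update_of_mem hi, sdiff_singleton_eq_erase, mul_comm (Fin.tail F i) (F 0), mul_assoc,
    mul_prod_erase S (Fin.tail F) hi, prod_insert (zero_notMem_map_succEmb' S), prod_tail_eq_prod_map']

/-! ### `E_n` as a polynomial in the joint moments -/

/-- The moment vector of the tail family: `S ↦ M(S+1)`. [folklore] -/
def tailMoments {n : ℕ} (M : Finset (Fin (n + 2)) → ℝ) : Finset (Fin (n + 1)) → ℝ :=
  fun S => M (S.map (Fin.succEmb (n + 1)))

/-- The moment vector of the tail family with slot `i` multiplied by the head:
`S ↦ M({0} ∪ (S+1))` if `i ∈ S`, `M(S+1)` otherwise. [folklore] -/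
def updMoments {n : ℕ} (i : Fin (n + 1)) (M : Finset (Fin (n + 2)) → ℝ) : Finset (Fin (n + 1)) → ℝ :=
  fun S => if i ∈ S then M (insert 0 (S.map (Fin.succEmb (n + 1)))) else M (S.map (Fin.succEmb (n + 1)))

/-- **`E_n` as a function of the joint-moment vector** `M : Finset (Fin n) → ℝ` (`M S` playing the role of
`𝔼(Π_{i∈S} f_i)`): the Lieb–Sahi recursion of Prop. 3.3 at the level of moments,
`P_{n+2}(M) = Σ_{i ≤ n} P_{n+1}(M ∘ [slot i absorbs the head]) − P_{n+1}(M ∘ tail) · M{0}`, `P_1(M) = M{0}`,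
`P_0 = 0`.  (Every `E_σ` of Definition 3.1 is a product of joint moments; this is the resulting polynomial.)
[cite: LiebSahi2021, Def. 3.1 and Prop. 3.3] -/
def momentE : (n : ℕ) → (Finset (Fin n) → ℝ) → ℝ
  | 0, _ => 0
  | 1, M => M {0}
  | n + 2, M => (∑ i : Fin (n + 1), momentE (n + 1) (updMoments i M)) - momentE (n + 1) (tailMoments M) * M {0}

/-- `P_0 = 0` (the junk value `E_0 := 0` of the tree's recursion, as in `sahiE_zero`).
[cite: LiebSahi2021, Def. 3.1 and Prop. 3.3] -/
theorem momentE_zero (M : Finset (Fin 0) → ℝ) : momentE 0 M = 0 := rfl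

/-- `P_1(M) = M{0}`. [cite: LiebSahi2021, eq. (1.1)] -/
theorem momentE_one (M : Finset (Fin 1) → ℝ) : momentE 1 M = M {0} := rfl

/-- The recursion for `P_{n+2}` (definitional). [cite: LiebSahi2021, Prop. 3.3] -/
theorem momentE_succ_succ (n : ℕ) (M : Finset (Fin (n + 2)) → ℝ) :
    momentE (n + 2) M =
      (∑ i : Fin (n + 1), momentE (n + 1) (updMoments i M)) - momentE (n + 1) (tailMoments M) * M {0} := rfl

/-- **The finite-weight `E_n` is the moment polynomial evaluated at the joint moments**
`S ↦ E(Π_{i∈S} f_i)`. [cite: LiebSahi2021, Def. 3.1 and Prop. 3.3] -/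
theorem sahiE_eq_momentE {α : Type*} [Fintype α] (μ : α → ℝ) :
    ∀ (n : ℕ) (f : Fin n → α → ℝ), sahiE μ n f = momentE n (fun S => ex μ (∏ i ∈ S, f i))
  | 0, f => by rw [sahiE_zero, momentE_zero]
  | 1, f => by rw [sahiE_one_apply, momentE_one, prod_singleton]
  | n + 2, f => by
    rw [sahiE_succ_succ, momentE_succ_succ, prod_singleton]
    have htail : (fun S : Finset (Fin (n + 1)) => ex μ (∏ i ∈ S, Fin.tail f i)) =
        tailMoments (fun S => ex μ (∏ i ∈ S, f i)) := by
      funext S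
      rw [tailMoments, prod_tail_eq_prod_map']
    have hupd : ∀ i : Fin (n + 1),
        (fun S : Finset (Fin (n + 1)) => ex μ (∏ j ∈ S, update (Fin.tail f) i (Fin.tail f i * f 0) j)) =
          updMoments i (fun S => ex μ (∏ i ∈ S, f i)) := by
      intro i
      funext S
      by_cases hi : i ∈ S
      · rw [updMoments, if_pos hi, prod_update_tail_mul_head' f hi]
      · rw [updMoments, if_neg hi, prod_update_of_notMem hi, prod_tail_eq_prod_map']
    rw [sahiE_eq_momentE μ (n + 1) (Fin.tail f), htail]
    congr 1
    exact sum_congr rfl fun i _ => by rw [sahiE_eq_momentE μ (n + 1), hupd i]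

/-- **`E_n` is continuous in the joint moments** (it is a polynomial in them).  Used for the `L¹`-limit
passages of [LiebSahi2021, Lemmas 2.3 and 3.8]. [cite: LiebSahi2021, Def. 3.1 and Lemma 2.3] -/
theorem continuous_momentE : ∀ n : ℕ, Continuous (momentE n)
  | 0 => continuous_const
  | 1 => continuous_apply _
  | n + 2 => by
    have hT : Continuous fun M : Finset (Fin (n + 2)) → ℝ => tailMoments M :=
      continuous_pi fun S => continuous_apply _
    have hR : ∀ i : Fin (n + 1), Continuous fun M : Finset (Fin (n + 2)) → ℝ => updMoments i M := by
      intro i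
      refine continuous_pi fun S => ?_
      by_cases hi : i ∈ S
      · simp only [updMoments, if_pos hi]
        exact continuous_apply _
      · simp only [updMoments, if_neg hi]
        exact continuous_apply _
    have h : momentE (n + 2) = fun M =>
        (∑ i : Fin (n + 1), momentE (n + 1) (updMoments i M)) -
          momentE (n + 1) (tailMoments M) * M {0} := by
      funext M
      rfl
    rw [h]
    exact (continuous_finsetSum _ fun i _ => (continuous_momentE (n + 1)).comp (hR i)).sub
      (((continuous_momentE (n + 1)).comp hT).mul (continuous_apply _))

/-! ### `E_n` for functions on a measure space -/

variable {Ω : Type*} [MeasurableSpace Ω]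

/-- **Sahi's functional `E_n(f_0,…,f_{n−1})` for real functions on a measure space `(Ω, μ)`** (a probability
space in the applications), `𝔼 = ∫ · dμ`: defined by the Lieb–Sahi recursion with the distinguished function in
slot `0`, `E_{n+2}(f_0, g_0,…,g_n) = Σ_{i ≤ n} E_{n+1}(g_0,…,g_i·f_0,…,g_n) − E_{n+1}(g_0,…,g_n)·𝔼(f_0)`,
`E_1(f) = 𝔼(f)`, junk value `E_0 := 0` — verbatim the tree's `sahiE` with the finite weighted sum replaced by the
integral.  Equal to the cycle sum of Definition 3.1 by Prop. 3.3.
[cite: LiebSahi2021, Def. 3.1, Prop. 3.3 and eq. (1.1)] -/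
def msahiE (μ : Measure Ω) : (n : ℕ) → (Fin n → Ω → ℝ) → ℝ
  | 0, _ => 0
  | 1, f => ∫ x, f 0 x ∂μ
  | n + 2, f =>
      (∑ i : Fin (n + 1), msahiE μ (n + 1) (update (Fin.tail f) i (Fin.tail f i * f 0))) -
        msahiE μ (n + 1) (Fin.tail f) * ∫ x, f 0 x ∂μ

/-- The junk value `E_0 = 0` of the recursion (as in `sahiE_zero`). [cite: LiebSahi2021, Def. 3.1 and Prop. 3.3] -/
theorem msahiE_zero (μ : Measure Ω) (f : Fin 0 → Ω → ℝ) : msahiE μ 0 f = 0 := rfl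

/-- `E_1(f) = 𝔼(f) = ∫ f dμ`. [cite: LiebSahi2021, eq. (1.1)] -/
theorem msahiE_one_apply (μ : Measure Ω) (f : Fin 1 → Ω → ℝ) : msahiE μ 1 f = ∫ x, f 0 x ∂μ := rfl

/-- **The Lieb–Sahi recursion** (definitional): `E_{n+2}(f) = Σ_i E_{n+1}(tail f, slot i times f_0) −
E_{n+1}(tail f)·𝔼(f_0)`. [cite: LiebSahi2021, Prop. 3.3] -/
theorem msahiE_succ_succ (μ : Measure Ω) (n : ℕ) (f : Fin (n + 2) → Ω → ℝ) :
    msahiE μ (n + 2) f =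
      (∑ i : Fin (n + 1), msahiE μ (n + 1) (update (Fin.tail f) i (Fin.tail f i * f 0))) -
        msahiE μ (n + 1) (Fin.tail f) * ∫ x, f 0 x ∂μ := rfl

/-- `E_1(f) = ∫ f dμ`. [cite: LiebSahi2021, eq. (1.1)] -/
theorem msahiE_one (μ : Measure Ω) (f : Ω → ℝ) : msahiE μ 1 ![f] = ∫ x, f x ∂μ := rfl

/-- `E_2(f,g) = 𝔼(fg) − 𝔼(f)𝔼(g)`. [cite: LiebSahi2021, eq. (1.1)] -/
theorem msahiE_two (μ : Measure Ω) (f g : Ω → ℝ) :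
    msahiE μ 2 ![f, g] = (∫ x, f x * g x ∂μ) - (∫ x, f x ∂μ) * ∫ x, g x ∂μ := by
  simp only [msahiE, Nat.reduceAdd, univ_unique, Fin.default_eq_zero, Fin.isValue, Fin.tail_vecCons,
    Matrix.cons_val_fin_one, Matrix.cons_val_zero, sum_singleton, Function.update_self, Pi.mul_apply]
  simp only [mul_comm]

/-- **`E_3`** on a measure space: `E_3(f,g,h) = 2𝔼(fgh) + 𝔼(f)𝔼(g)𝔼(h) − (𝔼(f)𝔼(gh) + 𝔼(g)𝔼(fh) + 𝔼(h)𝔼(fg))`.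
[cite: LiebSahi2021, eq. (2.1); Sahi2008, p. 213] -/
theorem msahiE_three (μ : Measure Ω) (f g h : Ω → ℝ) :
    msahiE μ 3 ![f, g, h] = 2 * (∫ x, f x * g x * h x ∂μ) + (∫ x, f x ∂μ) * (∫ x, g x ∂μ) * (∫ x, h x ∂μ) -
      ((∫ x, f x ∂μ) * (∫ x, g x * h x ∂μ) + (∫ x, g x ∂μ) * (∫ x, f x * h x ∂μ) +
        (∫ x, h x ∂μ) * (∫ x, f x * g x ∂μ)) := by
  simp only [msahiE, Nat.reduceAdd, univ_unique, Fin.default_eq_zero, Fin.isValue, Function.update, Fin.tail,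
    Matrix.cons_val_succ, Matrix.cons_val_zero, eq_rec_constant, Matrix.cons_val_fin_one, dite_eq_ite,
    Fin.succ_zero_eq_one, Matrix.cons_val_one, Fin.succ_one_eq_two, Matrix.cons_val,
    sum_singleton, reduceIte, sum_sub_distrib, Fin.sum_univ_succ, one_ne_zero, zero_ne_one, Pi.mul_apply,
    ite_apply]
  simp only [mul_comm, mul_left_comm, mul_assoc]
  ring

/-- **The measure-level `E_n` is the moment polynomial at the joint moments** `S ↦ ∫ Π_{i∈S} f_i dμ`.
[cite: LiebSahi2021, Def. 3.1 and Prop. 3.3] -/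
theorem msahiE_eq_momentE (μ : Measure Ω) :
    ∀ (n : ℕ) (f : Fin n → Ω → ℝ), msahiE μ n f = momentE n (fun S => ∫ x, (∏ i ∈ S, f i) x ∂μ)
  | 0, f => by rw [msahiE_zero, momentE_zero]
  | 1, f => by simp only [msahiE_one_apply, momentE_one, prod_singleton]
  | n + 2, f => by
    rw [msahiE_succ_succ, momentE_succ_succ]
    simp only [prod_singleton]
    have htail : (fun S : Finset (Fin (n + 1)) => ∫ x, (∏ i ∈ S, Fin.tail f i) x ∂μ) =
        tailMoments (fun S => ∫ x, (∏ i ∈ S, f i) x ∂μ) := by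
      funext S
      rw [tailMoments, prod_tail_eq_prod_map']
    have hupd : ∀ i : Fin (n + 1),
        (fun S : Finset (Fin (n + 1)) => ∫ x, (∏ j ∈ S, update (Fin.tail f) i (Fin.tail f i * f 0) j) x ∂μ) =
          updMoments i (fun S => ∫ x, (∏ i ∈ S, f i) x ∂μ) := by
      intro i
      funext S
      by_cases hi : i ∈ S
      · rw [updMoments, if_pos hi, prod_update_tail_mul_head' f hi]
      · rw [updMoments, if_neg hi, prod_update_of_notMem hi, prod_tail_eq_prod_map']
    rw [msahiE_eq_momentE μ (n + 1) (Fin.tail f), htail]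
    congr 1
    exact sum_congr rfl fun i _ => by rw [msahiE_eq_momentE μ (n + 1), hupd i]

/-- **Moment congruence, two measures**: families with the same joint moments `∫ Π_{i∈S} f_i dμ =
∫ Π_{i∈S} g_i dν` (all `S`) have the same `E_n` — manifest in Definition 3.1.
[cite: LiebSahi2021, Def. 3.1] -/
theorem msahiE_congr_of_moments {Ω' : Type*} [MeasurableSpace Ω'] (μ : Measure Ω) (ν : Measure Ω') {n : ℕ}
    (f : Fin n → Ω → ℝ) (g : Fin n → Ω' → ℝ)
    (h : ∀ S : Finset (Fin n), ∫ x, (∏ i ∈ S, f i) x ∂μ = ∫ y, (∏ i ∈ S, g i) y ∂ν) :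
    msahiE μ n f = msahiE ν n g := by
  rw [msahiE_eq_momentE, msahiE_eq_momentE]
  congr 1
  funext S
  exact h S

/-- **Moment congruence, a measure and a finite weight** (the discretisation bridge): if
`∫ Π_{i∈S} f_i dμ = E_w(Π_{i∈S} g_i)` for every `S`, then `E_n^μ(f) = E_n^w(g)` (the right-hand side being the
tree's finite `sahiE`). [cite: LiebSahi2021, Def. 3.1 and Lemma 2.3] -/
theorem msahiE_eq_sahiE_of_moments {α : Type*} [Fintype α] (μ : Measure Ω) (w : α → ℝ) {n : ℕ}
    (f : Fin n → Ω → ℝ) (g : Fin n → α → ℝ)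
    (h : ∀ S : Finset (Fin n), ∫ x, (∏ i ∈ S, f i) x ∂μ = ex w (∏ i ∈ S, g i)) :
    msahiE μ n f = sahiE w n g := by
  rw [msahiE_eq_momentE, sahiE_eq_momentE]
  congr 1
  funext S
  exact h S

/-- **Invariance under measure-preserving maps**: if `φ : Ω' → Ω` pushes `ν` to `μ` and is a measurable
embedding (e.g. a measurable bijection such as the reflection `x ↦ 1 − x` of [LiebSahi2021, §2]), then
`E_n^ν(f_0 ∘ φ,…,f_{n−1} ∘ φ) = E_n^μ(f_0,…,f_{n−1})` (all joint moments agree by the change of variables).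
[cite: LiebSahi2021, Def. 3.1 and §2 (change of variables `x_i ↦ 1 − x_i`)] -/
theorem msahiE_comp_measurePreserving {Ω' : Type*} [MeasurableSpace Ω'] {μ : Measure Ω} {ν : Measure Ω'}
    {φ : Ω' → Ω} (hφ : MeasurePreserving φ ν μ) (he : MeasurableEmbedding φ) (n : ℕ) (f : Fin n → Ω → ℝ) :
    msahiE ν n (fun i => f i ∘ φ) = msahiE μ n f := by
  refine msahiE_congr_of_moments ν μ _ f fun S => ?_
  have h : (∏ i ∈ S, (f i ∘ φ)) = (∏ i ∈ S, f i) ∘ φ := by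
    funext x
    simp only [Finset.prod_apply, Function.comp_apply]
  rw [h]
  exact hφ.integral_comp he _

/-- **Sahi positivity of order `n` of a measure** on a measurable preorder: `E_n(f_0,…,f_{n−1}) ≥ 0` for all
pointwise nonnegative monotone families (the measure-level twin of `SahiPositive`; "positive monotone" =
nonnegative and monotone [LiebSahi2021, footnote 2]; the decreasing version is the same property of the order
dual).  A PROPERTY, appearing in this topic only as the conclusion of proved theorems.
[cite: LiebSahi2021, Conj. 1.1 and eq. (1.2)] -/
def MSahiPositive [Preorder Ω] (μ : Measure Ω) (n : ℕ) : Prop :=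
  ∀ f : Fin n → Ω → ℝ, (∀ i x, 0 ≤ f i x) → (∀ i, Monotone (f i)) → 0 ≤ msahiE μ n f

/-- Order `1`: `E_1(f) = ∫ f dμ ≥ 0` for `f ≥ 0`. [cite: LiebSahi2021, eq. (1.2)] -/
theorem mSahiPositive_one [Preorder Ω] (μ : Measure Ω) : MSahiPositive μ 1 := fun f hf _ => by
  rw [msahiE_one_apply]
  exact integral_nonneg (hf 0)

/-! ### Consistency with the finite-weight and event-level functionals of the tree -/

section Weight

variable {α : Type*} [Fintype α] [MeasurableSpace α] [MeasurableSingletonClass α]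

/-- The measure `Σ_a w(a)·δ_a` of a nonnegative finite weight `w`. [folklore] -/
def weightMeasure (w : α → ℝ) : Measure α := ∑ a, ENNReal.ofReal (w a) • Measure.dirac a

omit [MeasurableSingletonClass α] in
/-- `weightMeasure w` is a finite measure. [folklore] -/
instance isFiniteMeasure_weightMeasure (w : α → ℝ) : IsFiniteMeasure (weightMeasure w) := by
  refine ⟨?_⟩
  rw [weightMeasure, Measure.coe_finsetSum, Finset.sum_apply]
  refine ENNReal.sum_lt_top.2 fun a _ => ?_
  rw [Measure.coe_smul, Pi.smul_apply, smul_eq_mul]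
  exact ENNReal.mul_lt_top ENNReal.ofReal_lt_top (measure_lt_top _ _)

/-- The mass of a singleton under `Σ_a w(a)·δ_a` is `w(a)` (plumbing). [folklore] -/
private theorem weightMeasure_real_singleton {w : α → ℝ} (hw : ∀ a, 0 ≤ w a) (a : α) :
    (weightMeasure w).real {a} = w a := by
  classical
  rw [measureReal_def, weightMeasure, Measure.coe_finsetSum, Finset.sum_apply]
  simp only [Measure.coe_smul, Pi.smul_apply, Measure.dirac_apply' _ (measurableSet_singleton a),
    Set.indicator_apply, Set.mem_singleton_iff, Pi.one_apply, smul_eq_mul, mul_ite, mul_one, mul_zero,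
    Finset.sum_ite_eq', Finset.mem_univ, if_true]
  exact ENNReal.toReal_ofReal (hw a)

/-- Integrals against `Σ_a w(a)·δ_a` are the weighted sums `E_w` (plumbing). [folklore] -/
private theorem integral_weightMeasure {w : α → ℝ} (hw : ∀ a, 0 ≤ w a) (g : α → ℝ) :
    ∫ x, g x ∂(weightMeasure w) = ex w g := by
  rw [integral_fintype (Integrable.of_finite (μ := weightMeasure w) (f := g)), ex]
  exact sum_congr rfl fun a _ => by rw [weightMeasure_real_singleton hw, smul_eq_mul]

/-- **The measure-level `E_n` extends the finite-weight one**: under `Σ_a w(a)·δ_a`, `E_n` is `sahiE w n`.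
[cite: LiebSahi2021, Def. 3.1] -/
theorem msahiE_weightMeasure {w : α → ℝ} (hw : ∀ a, 0 ≤ w a) (n : ℕ) (f : Fin n → α → ℝ) :
    msahiE (weightMeasure w) n f = sahiE w n f :=
  msahiE_eq_sahiE_of_moments _ _ f f fun _ => integral_weightMeasure hw _

end Weight

/-- **On indicators of three measurable events, `E_3` is the event-level `sahiE3`** of
`Literature/Probability/LatticeModels/SahiThirdOrderCorrelation.lean`:
`E_3(1_A,1_B,1_C) = 2μ(A∩B∩C) + μ(A)μ(B)μ(C) − (μ(A)μ(B∩C) + μ(B)μ(A∩C) + μ(C)μ(A∩B))`.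
[cite: LiebSahi2021, eq. (2.1)] -/
theorem msahiE_three_indicator (μ : Measure Ω) {A B C : Set Ω} (hA : MeasurableSet A)
    (hB : MeasurableSet B) (hC : MeasurableSet C) :
    msahiE μ 3 ![A.indicator 1, B.indicator 1, C.indicator 1] =
      Literature.Probability.LatticeModels.sahiE3 μ A B C := by
  rw [msahiE_three, Literature.Probability.LatticeModels.sahiE3_def]
  have i1 : ∀ (S : Set Ω), MeasurableSet S → ∫ x, S.indicator (1 : Ω → ℝ) x ∂μ = μ.real S :=
    fun S hS => integral_indicator_one hS
  have i2 : ∀ (S T : Set Ω), MeasurableSet S → MeasurableSet T →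
      ∫ x, S.indicator (1 : Ω → ℝ) x * T.indicator 1 x ∂μ = μ.real (S ∩ T) := by
    intro S T hS hT
    rw [← integral_indicator_one (hS.inter hT)]
    refine integral_congr_ae (Filter.Eventually.of_forall fun x => ?_)
    simp only [Set.inter_indicator_one, Pi.mul_apply]
  have i3 : ∫ x, A.indicator (1 : Ω → ℝ) x * B.indicator 1 x * C.indicator 1 x ∂μ = μ.real (A ∩ B ∩ C) := by
    rw [← integral_indicator_one ((hA.inter hB).inter hC)]
    refine integral_congr_ae (Filter.Eventually.of_forall fun x => ?_)
    simp only [Set.inter_indicator_one, Pi.mul_apply]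
  rw [i1 A hA, i1 B hB, i1 C hC, i2 A B hA hB, i2 A C hA hC, i2 B C hB hC, i3]

end Literature.Combinatorics.Sahi2008
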